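import Summits.Langlands.Langlands.Theses.QuarterDeficit1951
import Literature.NumberTheory.GaloisRepresentations.DoudMooreEvenIcosahedral
import Literature.NumberTheory.GaloisRepresentations.TateUnramifiedLiftingHolds
import Literature.NumberTheory.GaloisRepresentations.PadicComplexEmbedding
import Literature.NumberTheory.GaloisRepresentations.DirichletCharacterOfGaloisCharacter
import Literature.NumberTheory.GaloisRepresentations.GaloisRepUnramifiedProofs
import Literature.NumberTheory.GaloisRepresentations.UnramifiedDatum
import HarnessLib

/-!
# Sketch — first lemmas for the crux ideas on `QuarterDeficit1951.IcosahedralSupply`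
(crux item stmt-Langlands-15899; crux-ideate round 1, ideator 1)

Statements only need to ELABORATE (crux-ideate contract); a few are proved where cheap.

* §0 shared: `∃ ι`, and the FREE de Rham clause at a prime `ℓ` where `ρ` is unramified
  (structure axiom of `PstWeilDeligneData`, valid for EVERY datum, hence for the pinned one).
* §A card `iota-transport-open-kernel`: open-kernel transport along an arbitrary ring hom and the
  invariance of the conductor under a ring isomorphism of coefficients.
* §C card `discrete-tate-lift-padic`: Tate's lifting theorem (a THEOREM of the tree for discrete
  algebraically closed `k`) read with `k = ℚ̄_ℓ` carrying the discrete topology, then re-topologised.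
* §D card `fontaine-clause-f9`: the candidate clause (F9) and the tightness fact that the structure
  axioms alone cannot give de Rham-ness of a ramified representation (truncated datum).
* §T the sharpened Doud–Moore cite (type 3a at 1951) that lines A and C consume for `orderOf χ₀ = 5`.
-/

noncomputable section

open scoped MatrixGroups NumberField
open Field IsDedekindDomain
open Literature.NumberTheory.GaloisRepresentations Literature.NumberTheory.PAdicHodge

set_option linter.dupNamespace false

namespace Summit.Langlands.Langlands.Cruxes.IcosahedralSupply.Sketch

/-! ## §0 Shared -/

/-- `∃ ι : ℚ̄_ℓ ≃+* ℂ` (cardinality; tree `nonempty_algebraicClosure_padic_ringEquiv_complex`). -/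
theorem exists_iota (ℓ : ℕ) [Fact ℓ.Prime] : Nonempty (PadicAlgCl ℓ ≃+* ℂ) :=
  Literature.NumberTheory.GaloisRepresentations.NumberField.nonempty_algebraicClosure_padic_ringEquiv_complex ℓ

/-- **Free de Rham clause.** At a place `v ∣ ℓ` where `ρ` is unramified, `ρ|_{Γ_{ℚ_v}}` is de Rham for
the PINNED datum `RD.pst ℓ v hv` — for EVERY `PstWeilDeligneData` (structure axiom
`isDeRhamWith_of_isLocallyUnramified`), no `FontaineDatumExists` needed; the local–global bridge
is the proved `GaloisRep.isUnramifiedAt_iff_toLocal_holds`. -/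
theorem isDeRhamFramed_pst_of_isUnramifiedAt (RD : Summit.Langlands.ReciprocityData ℚ) {ℓ : ℕ}
    [Fact ℓ.Prime] {n : ℕ} (ρ : FramedGaloisRep ℚ (PadicAlgCl ℓ) n)
    (v : HeightOneSpectrum (𝓞 ℚ)) (hv : ((ℓ : ℕ) : 𝓞 ℚ) ∈ v.asIdeal) (hρ : ρ.IsUnramifiedAt v) :
    (RD.pst ℓ v hv).IsDeRhamFramed (ρ.toLocal v) := by
  refine (RD.pst ℓ v hv).isDeRhamFramed_of_isLocallyUnramified ?_
  intro σ hσ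
  have h1 := ((GaloisRep.isUnramifiedAt_iff_toLocal_holds v ρ.toGaloisRep).mp
    ((FramedGaloisRep.isUnramifiedAt_toGaloisRep_iff v ρ).mpr hρ)) σ hσ
  rw [GaloisRep.toLocal_apply] at h1
  rw [FramedGaloisRep.toLocal_apply]
  have h2 : Matrix.toLin' ((ρ (absGaloisRestrict ℚ (v.adicCompletion ℚ) σ) : GL (Fin n) (PadicAlgCl ℓ)) :
      Matrix (Fin n) (Fin n) (PadicAlgCl ℓ)) = Matrix.toLin' 1 := by
    rw [Matrix.toLin'_one]
    refine LinearMap.ext fun w => ?_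
    simpa using congr($h1 w)
  exact Units.ext (Matrix.toLin'.injective h2)

/-- Hence an `ρ : Γ_ℚ → GL_n(ℚ̄_ℓ)` unramified almost everywhere and unramified AT `ℓ` is geometric in
the summit's sense, for every reciprocity datum. -/
theorem isGeometricFramed_of_isUnramifiedAt (RD : Summit.Langlands.ReciprocityData ℚ) {ℓ : ℕ}
    [Fact ℓ.Prime] {n : ℕ} (ρ : FramedGaloisRep ℚ (PadicAlgCl ℓ) n)
    (hae : ∀ᶠ v : HeightOneSpectrum (𝓞 ℚ) in Filter.cofinite, ρ.IsUnramifiedAt v)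
    (hℓ : ∀ v : HeightOneSpectrum (𝓞 ℚ), ((ℓ : ℕ) : 𝓞 ℚ) ∈ v.asIdeal → ρ.IsUnramifiedAt v) :
    Summit.Langlands.IsGeometricFramed RD ρ :=
  ⟨hae, fun v hv => isDeRhamFramed_pst_of_isUnramifiedAt RD ρ v hv (hℓ v hv)⟩

/-! ## §A Card `iota-transport-open-kernel` -/

section Transport

variable {G : Type*} [Group G] [TopologicalSpace G] [IsTopologicalGroup G]
  {A B : Type*} [CommRing A] [TopologicalSpace A] [CommRing B] [TopologicalSpace B]
  [IsTopologicalRing B] {n : ℕ}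

/-- **Open-kernel transport.** A framed representation with open kernel transports along an
ARBITRARY ring homomorphism `f` (no continuity of `f`: the transported homomorphism is locally
constant, `MonoidHom.continuous_of_isOpen_ker`). This replaces `FramedRep.baseChange` (which needs
`Continuous f`) for `f = ι⁻¹ : ℂ → ℚ̄_ℓ`. -/
def transportOfIsOpenKer (f : A →+* B) (ρ : FramedRep G A n)
    (hρ : IsOpen ((ρ.toMonoidHom.ker : Subgroup G) : Set G)) : FramedRep G B n where
  toMonoidHom := (Matrix.GeneralLinearGroup.map f).comp ρ.toMonoidHom
  continuous_toFun := by
    refine MonoidHom.continuous_of_isOpen_ker _ ?_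
    have hle : ρ.toMonoidHom.ker ≤ ((Matrix.GeneralLinearGroup.map (n := Fin n) f).comp ρ.toMonoidHom).ker :=
      fun g hg => by
        rw [MonoidHom.mem_ker] at hg ⊢
        rw [MonoidHom.comp_apply, hg, map_one]
    apply Subgroup.isOpen_mono hle hρ

@[simp] theorem transportOfIsOpenKer_apply (f : A →+* B) (ρ : FramedRep G A n)
    (hρ : IsOpen ((ρ.toMonoidHom.ker : Subgroup G) : Set G)) (g : G) :
    transportOfIsOpenKer f ρ hρ g = Matrix.GeneralLinearGroup.map f (ρ g) := rfl

end Transport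

/-- **Conductor invariance under a coefficient isomorphism** (the load-bearing invariance of card A):
if `ρℂ = ι ∘ ρ` entrywise for a ring ISOMORPHISM `ι : ℚ̄_ℓ ≃+* ℂ`, the numerical Artin conductors agree
— every ingredient of `artinConductorNat` is a `codimFixed` (rank of a finite family of matrices
`ρ(σ) - 1`, `σ` in an inertia / ramification subgroup), invariant under entrywise field isomorphism. -/
theorem artinConductorNat_eq_of_transport {ℓ : ℕ} [Fact ℓ.Prime] {n : ℕ} (ι : PadicAlgCl ℓ ≃+* ℂ)
    (ρ : FramedGaloisRep ℚ (PadicAlgCl ℓ) n) (ρℂ : FramedArtinRep ℚ n)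
    (h : ∀ σ, ρℂ σ = Matrix.GeneralLinearGroup.map (ι : PadicAlgCl ℓ →+* ℂ) (ρ σ)) :
    ρ.toGaloisRep.artinConductorNat = ρℂ.toGaloisRep.artinConductorNat := by
  sorry

/-- The other clause invariances of card A (statements; each is a few lines):
evenness, icosahedral type, unramifiedness, Frobenius characteristic polynomials. -/
theorem clauses_of_transport {ℓ : ℕ} [Fact ℓ.Prime] (ι : PadicAlgCl ℓ ≃+* ℂ)
    (ρ : FramedGaloisRep ℚ (PadicAlgCl ℓ) 2) (ρℂ : FramedArtinRep ℚ 2)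
    (h : ∀ σ, ρℂ σ = Matrix.GeneralLinearGroup.map (ι : PadicAlgCl ℓ →+* ℂ) (ρ σ)) :
    (ρℂ.IsEven ↔ ρ.IsEven) ∧
    (IsIcosahedralType ρℂ.toMonoidHom ↔ IsIcosahedralType ρ.toMonoidHom) ∧
    (∀ v, ρℂ.IsUnramifiedAt v ↔ ρ.IsUnramifiedAt v) ∧
    (∀ v (P : Polynomial (PadicAlgCl ℓ)), ρ.HasFrobCharpolyAt v P ↔
      ρℂ.HasFrobCharpolyAt v (P.map (ι : PadicAlgCl ℓ →+* ℂ))) := by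
  sorry

/-! ## §C Card `discrete-tate-lift-padic` -/

section DiscreteCopy

/-- `ℚ̄_ℓ` with the DISCRETE topology (a type synonym; same field, same algebraic closure). -/
def DiscQl (ℓ : ℕ) [Fact ℓ.Prime] : Type := PadicAlgCl ℓ

variable (ℓ : ℕ) [Fact ℓ.Prime]

instance : Field (DiscQl ℓ) := inferInstanceAs (Field (PadicAlgCl ℓ))
instance : IsAlgClosed (DiscQl ℓ) := inferInstanceAs (IsAlgClosed (PadicAlgCl ℓ))
instance : TopologicalSpace (DiscQl ℓ) := ⊥
instance : DiscreteTopology (DiscQl ℓ) := ⟨rfl⟩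

/-- The identity `ℚ̄_ℓ → ℚ̄_ℓ^disc` as a ring homomorphism. -/
def DiscQl.ofPadic : PadicAlgCl ℓ →+* DiscQl ℓ := RingHom.id (PadicAlgCl ℓ)

/-- The identity `ℚ̄_ℓ^disc → ℚ̄_ℓ` as a ring homomorphism. -/
def DiscQl.toPadic : DiscQl ℓ →+* PadicAlgCl ℓ := RingHom.id (PadicAlgCl ℓ)

theorem DiscQl.toPadic_comp_ofPadic :
    (DiscQl.toPadic ℓ).comp (DiscQl.ofPadic ℓ) = RingHom.id (PadicAlgCl ℓ) :=
  RingHom.ext fun _ => rfl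

end DiscreteCopy

/-- **Tate's lift straight into `ℚ̄_ℓ`.** A projective representation `ρ̃ : Γ_ℚ → PGL_n(ℚ̄_ℓ)` with
open kernel, unramified outside a finite `S`, has an `ℓ`-ADIC lift (continuous for the valuation
topology of `ℚ̄_ℓ`) with open kernel, unramified outside `S`. Proof idea: apply the tree THEOREM
`Tate_projectiveLifting_unramifiedOutside_holds` to `k := ℚ̄_ℓ` equipped with the DISCRETE topology
(a type synonym), then re-topologise: a homomorphism continuous for the discrete topology on `k` has
open kernel, hence is continuous for every topology on `GL_n(k)`. -/
theorem exists_padicLift_of_projective {n : ℕ} (ℓ : ℕ) [Fact ℓ.Prime]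
    (ρt : absoluteGaloisGroup ℚ →* PGL(n, PadicAlgCl ℓ))
    (hker : IsOpen ((ρt.ker : Subgroup (absoluteGaloisGroup ℚ)) : Set (absoluteGaloisGroup ℚ)))
    (S : Set (HeightOneSpectrum (𝓞 ℚ))) (hS : S.Finite)
    (hunr : ∀ v ∉ S, ∀ 𝔓 ∈ v.primesAbove, ∀ σ ∈ 𝔓.inertia (absoluteGaloisGroup ℚ), ρt σ = 1) :
    ∃ ρ : FramedGaloisRep ℚ (PadicAlgCl ℓ) n,
      (∀ σ, Matrix.ProjGenLinGroup.mk (ρ σ) = ρt σ) ∧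
      IsOpen ((ρ.toMonoidHom.ker : Subgroup (absoluteGaloisGroup ℚ)) : Set (absoluteGaloisGroup ℚ)) ∧
      ∀ v ∉ S, ρ.IsUnramifiedAt v := by
  -- transport `ρt` to the DISCRETE copy of `ℚ̄_ℓ` (explicit `map`, no silent identification)
  let ρtd : absoluteGaloisGroup ℚ →* PGL(n, DiscQl ℓ) :=
    (Matrix.ProjGenLinGroup.map (DiscQl.ofPadic ℓ)).comp ρt
  have hle : ρt.ker ≤ ρtd.ker := fun σ hσ => by
    rw [MonoidHom.mem_ker] at hσ ⊢
    simp only [ρtd, MonoidHom.comp_apply, hσ, map_one]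
  have hkerd : IsOpen ((ρtd.ker : Subgroup (absoluteGaloisGroup ℚ)) : Set (absoluteGaloisGroup ℚ)) :=
    Subgroup.isOpen_mono hle hker
  have hunrd : ∀ v ∉ S, ∀ 𝔓 ∈ v.primesAbove, ∀ σ ∈ 𝔓.inertia (absoluteGaloisGroup ℚ), ρtd σ = 1 :=
    fun v hv 𝔓 h𝔓 σ hσ => hle (by rw [MonoidHom.mem_ker]; exact hunr v hv 𝔓 h𝔓 σ hσ)
  -- Tate's theorem (a tree theorem) over the discrete algebraically closed field `DiscQl ℓ`
  obtain ⟨ρd, hlift, hunr'⟩ :=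
    Tate_projectiveLifting_unramifiedOutside_holds n (DiscQl ℓ) ρtd hkerd S hS hunrd
  -- its kernel is open (the target is discrete)
  have hkd : IsOpen ((ρd.toMonoidHom.ker : Subgroup (absoluteGaloisGroup ℚ)) :
      Set (absoluteGaloisGroup ℚ)) := by
    have hset : ((ρd.toMonoidHom.ker : Subgroup (absoluteGaloisGroup ℚ)) : Set (absoluteGaloisGroup ℚ)) =
        ρd ⁻¹' {1} := by
      ext σ
      simp only [SetLike.mem_coe, MonoidHom.mem_ker, Set.mem_preimage, Set.mem_singleton_iff]
      rfl
    rw [hset]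
    exact (isOpen_discrete _).preimage (map_continuous ρd)
  -- re-topologise: transport back along the identity `DiscQl ℓ →+* PadicAlgCl ℓ` (open kernel!)
  refine ⟨transportOfIsOpenKer (DiscQl.toPadic ℓ) ρd hkd, fun σ => ?_, ?_, fun v hv 𝔓 h𝔓 σ hσ => ?_⟩
  · rw [transportOfIsOpenKer_apply, ← Matrix.ProjGenLinGroup.map_mk, hlift σ]
    simp only [ρtd, MonoidHom.comp_apply]
    rw [← MonoidHom.comp_apply (Matrix.ProjGenLinGroup.map (DiscQl.toPadic ℓ)),
      ← Matrix.ProjGenLinGroup.map_comp, DiscQl.toPadic_comp_ofPadic, Matrix.ProjGenLinGroup.map_id,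
      MonoidHom.id_apply]
  · refine Subgroup.isOpen_mono (fun σ hσ => ?_) hkd
    rw [MonoidHom.mem_ker] at hσ ⊢
    change transportOfIsOpenKer (DiscQl.toPadic ℓ) ρd hkd σ = 1
    rw [transportOfIsOpenKer_apply]
    change Matrix.GeneralLinearGroup.map (DiscQl.toPadic ℓ) (ρd.toMonoidHom σ) = 1
    rw [hσ, map_one]
  · rw [transportOfIsOpenKer_apply, hunr' v hv 𝔓 h𝔓 σ hσ, map_one]

/-- **Klein's icosahedral embedding** (the finite-group input of card C): `A₅ ↪ PGL₂(ℚ̄_ℓ)`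
(explicit binary-icosahedral generators over `ℚ(ζ₅) ⊂ ℚ̄_ℓ`). -/
theorem exists_klein_embedding (ℓ : ℕ) [Fact ℓ.Prime] :
    ∃ f : alternatingGroup (Fin 5) →* PGL(2, PadicAlgCl ℓ), Function.Injective f := by
  sorry

/-- **The projective representation of the Doud–Moore FIELD** (card C, from the vendored field-level
fact + Klein): open kernel, image `≅ A₅`, unramified away from `1951`, complex conjugations in the
kernel (the field is totally real — whence EVERY lift is even: `ρ(c)` is a scalar of order `≤ 2`, so
`det ρ(c) = (±1)² = 1`). -/
theorem exists_projective_of_doudMooreField (ℓ : ℕ) [Fact ℓ.Prime]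
    (hK : doudMoore2006_exists_totallyReal_A5_quintic_1951)
    (hKlein : ∃ f : alternatingGroup (Fin 5) →* PGL(2, PadicAlgCl ℓ), Function.Injective f) :
    ∃ ρt : absoluteGaloisGroup ℚ →* PGL(2, PadicAlgCl ℓ),
      IsOpen ((ρt.ker : Subgroup (absoluteGaloisGroup ℚ)) : Set (absoluteGaloisGroup ℚ)) ∧
      Nonempty (ρt.range ≃* alternatingGroup (Fin 5)) ∧
      (∀ v : HeightOneSpectrum (𝓞 ℚ), v.residueCard ≠ 1951 →
        ∀ 𝔓 ∈ v.primesAbove, ∀ σ ∈ 𝔓.inertia (absoluteGaloisGroup ℚ), ρt σ = 1) ∧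
      (∀ (φ : ℚ →+* ℝ) (c : absoluteGaloisGroup ℚ), IsComplexConjugation φ c → ρt c = 1) := by
  sorry

/-- Evenness of ANY lift of a projective representation killing complex conjugations (card C's free
evenness): `ρ(c)` is central of order dividing `2`, so `det ρ(c) = ± 1` squared… precisely: `ρ(c)`
central means `ρ(c) = z • 1` with `z² = 1` (as `c² = 1`), and `det (z • 1) = z² = 1` in rank `2`. -/
theorem isEven_of_lift_of_conj_trivial {ℓ : ℕ} [Fact ℓ.Prime]
    (ρt : absoluteGaloisGroup ℚ →* PGL(2, PadicAlgCl ℓ)) (ρ : FramedGaloisRep ℚ (PadicAlgCl ℓ) 2)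
    (hlift : ∀ σ, Matrix.ProjGenLinGroup.mk (ρ σ) = ρt σ)
    (hc : ∀ (φ : ℚ →+* ℝ) (c : absoluteGaloisGroup ℚ), IsComplexConjugation φ c → ρt c = 1) :
    ρ.IsEven := by
  intro φ c hcc
  have h1 : Matrix.ProjGenLinGroup.mk (ρ c) = 1 := by rw [hlift c, hc φ c hcc]
  rw [Matrix.ProjGenLinGroup.mk_eq_one,
    Matrix.GeneralLinearGroup.mem_center_iff_val_mem_range_scalar] at h1
  obtain ⟨a, ha⟩ := h1
  have h2 : ρ c * ρ c = 1 := by rw [← map_mul, ← sq, hcc.sq_eq_one, map_one]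
  have h3 : a * a = 1 := by
    have h2' := congrArg (fun g : GL (Fin 2) (PadicAlgCl ℓ) => (g : Matrix (Fin 2) (Fin 2) (PadicAlgCl ℓ))) h2
    simp only [Units.val_mul, Units.val_one] at h2'
    rw [← ha, ← map_mul] at h2'
    have h2'' : Matrix.scalar (Fin 2) (a * a) = Matrix.scalar (Fin 2) (1 : PadicAlgCl ℓ) := by
      rw [h2', map_one]
    exact Matrix.scalar_inj.mp h2''
  apply Units.ext
  rw [Matrix.GeneralLinearGroup.val_det_apply, Units.val_one, ← ha, Matrix.scalar_apply,
    Matrix.det_diagonal, Fin.prod_univ_two, h3]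

/-! ## §D Card `fontaine-clause-f9-potentially-unramified` -/

section F9

variable {F : Type} [Field F] [ValuativeRel F] [TopologicalSpace F] [IsNonarchimedeanLocalField F]
  {ℓ : ℕ} [Fact ℓ.Prime]

/-- **Candidate clause (F9): potentially unramified representations are de Rham** (for the genuine
`B_dR`: potentially unramified ⇒ potentially crystalline ⇒ de Rham, i.e. de Rham-ness is insensitive
to finite extension of the base, `D_{dR,F'}(V) = F' ⊗_F D_{dR,F}(V)` by Galois descent / Hilbert 90,
Fontaine 1994 Exp. III §3; all Hodge–Tate weights `0`). Phrased inside ONE local field `F` (the pinned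
data at `F` and at `F'` are unrelated `ε`-terms, so no cross-field clause is statable): `ρ` kills
`U ∩ I_F` for some open subgroup `U`. -/
def PotentiallyUnramifiedIsDeRham (𝔇 : PstWeilDeligneData F ℓ) : Prop :=
  ∀ {n : ℕ} (ρ : FramedRep (absoluteGaloisGroup F) (PadicAlgCl ℓ) n),
    (∃ U : Subgroup (absoluteGaloisGroup F), IsOpen (U : Set (absoluteGaloisGroup F)) ∧
      ∀ σ ∈ U, σ ∈ absInertia F → ρ σ = 1) →
    𝔇.IsDeRhamFramed ρ

/-- **Tightness: the structure axioms alone cannot give it.** The accepted truncated datum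
`F̂_nr` (which inhabits `PstWeilDeligneData F ℓ` and satisfies every STRUCTURE axiom) makes a
representation de Rham iff it is unramified (tree, proved:
`unramifiedPstWeilDeligneData_isDeRhamFramed_iff`); so for it every RAMIFIED `ρ` fails to be de
Rham, and (F9) fails. Hence de Rham-ness of the (ramified at `1951`) Doud–Moore representation at
`ℓ = 1951` for the pinned datum can only come from a CLAUSE of `IsFontaineDatum` — and (F1)–(F8)
contain none about ramified potentially unramified representations. -/
theorem not_isDeRhamFramed_truncated_of_not_isLocallyUnramified [Algebra ℚ_[ℓ] F] {n : ℕ}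
    (ρ : FramedRep (absoluteGaloisGroup F) (PadicAlgCl ℓ) n) (h : ¬ ρ.IsLocallyUnramified) :
    ¬ (unramifiedPstWeilDeligneData F ℓ).IsDeRhamFramed ρ :=
  fun hd => h ((unramifiedPstWeilDeligneData_isDeRhamFramed_iff ρ).1 hd)

end F9

/-- Kernel of a restriction: if `ρ` has open kernel, so does `ρ ∘ r` for a continuous `r`. -/
theorem isOpen_ker_comp_of_isOpen_ker {Γ Γ' : Type*} [Group Γ] [TopologicalSpace Γ] [Group Γ']
    [TopologicalSpace Γ'] {A : Type*} [CommRing A] [TopologicalSpace A] {n : ℕ}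
    (ρ : FramedRep Γ A n) (r : Γ' →ₜ* Γ) (h : IsOpen ((ρ.toMonoidHom.ker : Subgroup Γ) : Set Γ)) :
    IsOpen (((ρ.comp r).toMonoidHom.ker : Subgroup Γ') : Set Γ') := by
  have hset : (((ρ.comp r).toMonoidHom.ker : Subgroup Γ') : Set Γ') = r ⁻¹' (ρ.toMonoidHom.ker : Set Γ) := by
    ext σ
    rfl
  rw [hset]
  exact h.preimage (map_continuous r)

/-- **What (F9) buys for the crux at `ℓ = 1951`** (and at every `ℓ`): under `FontaineDatumExists`
and the clause (as it would be available after the addition, i.e. for every datum with Fontaine's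
clauses), an open-kernel `ρ : Γ_ℚ → GL_n(ℚ̄_ℓ)` is de Rham at every `v ∣ ℓ` for the pinned datum. -/
theorem isDeRhamFramed_pst_of_isOpen_ker (hE : FontaineDatumExists)
    (hF9 : ∀ (F : Type) [Field F] [ValuativeRel F] [TopologicalSpace F] [IsNonarchimedeanLocalField F]
      [CharZero F] (ℓ : ℕ) [Fact ℓ.Prime] (hℓ : ValuativeRel.valuation F ℓ < 1)
      (𝔇 : PstWeilDeligneData F ℓ), IsFontaineDatum hℓ 𝔇 → PotentiallyUnramifiedIsDeRham 𝔇)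
    (RD : Summit.Langlands.ReciprocityData ℚ) {ℓ : ℕ} [Fact ℓ.Prime] {n : ℕ}
    (ρ : FramedGaloisRep ℚ (PadicAlgCl ℓ) n)
    (hker : IsOpen ((ρ.toMonoidHom.ker : Subgroup (absoluteGaloisGroup ℚ)) : Set (absoluteGaloisGroup ℚ)))
    (v : HeightOneSpectrum (𝓞 ℚ)) (hv : ((ℓ : ℕ) : 𝓞 ℚ) ∈ v.asIdeal) :
    (RD.pst ℓ v hv).IsDeRhamFramed (ρ.toLocal v) := by
  haveI := LocalField.charZero_adicCompletion v
  have hD := isFontaineDatum_fontainePstAdicCompletion hE v ℓ hv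
  change (fontainePstAdicCompletion v ℓ hv).IsDeRhamFramed (ρ.toLocal v)
  refine hF9 (v.adicCompletion ℚ) ℓ _ _ hD (ρ.toLocal v)
    ⟨(ρ.toLocal v).toMonoidHom.ker, ?_, fun σ hσ _ => (MonoidHom.mem_ker).mp hσ⟩
  exact isOpen_ker_comp_of_isOpen_ker ρ _ hker

/-! ## §T The sharpened Doud–Moore cite (type 3a at `1951`) -/

/-- **Doud–Moore 2006, §2 (type 3a: `p ≡ 1 (mod 5)`, `d_K = p⁴`, `e_p = 5`) with §4 (Table, row
`p = 1951`, found in the search "for each prime congruent to 1 modulo 5"):** the conductor-`1951`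
even icosahedral representation is of TYPE 3a — the image of an inertia group at `1951` in the
projective representation has an element of order `5`. This is the clause the vendored
`DoudMoore2006_minimalPrimeConductor` omits and which `orderOf χ₀ = 5` needs (conductor `1951`
alone allows type 3b, `e = 3`, since `1951 ≡ 1 (mod 3)`). Candidate text of a cite item. -/
def DoudMoore2006_conductor1951_type3a : Prop :=
  ∃ ρ : FramedArtinRep ℚ 2, ρ.IsEven ∧ IsIcosahedralType ρ.toMonoidHom ∧
    ρ.toGaloisRep.artinConductorNat = 1951 ∧
    ∀ v : HeightOneSpectrum (𝓞 ℚ), ((1951 : ℕ) : 𝓞 ℚ) ∈ v.asIdeal →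
      ∃ 𝔓 ∈ v.primesAbove, ∃ σ ∈ 𝔓.inertia (absoluteGaloisGroup ℚ),
        orderOf (Matrix.ProjGenLinGroup.mk (ρ σ)) = 5

/-- Field-level form of the same clause (for card C): `1951` is TOTALLY RAMIFIED (`e = 5`) in the
Doud–Moore quintic field. -/
def DoudMoore2006_quintic1951_totallyRamified : Prop :=
  ∃ (K : Type) (_ : Field K) (_ : NumberField K),
    Module.finrank ℚ K = 5 ∧ NumberField.IsTotallyReal K ∧
    (NumberField.discr K).natAbs = 1951 ^ 4 ∧
    (∃ θ : K, (minpoly ℚ θ).natDegree = 5 ∧ Nonempty ((minpoly ℚ θ).Gal ≃* alternatingGroup (Fin 5))) ∧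
    ∃ P : Ideal (𝓞 K), P.IsPrime ∧ P.comap (algebraMap ℤ (𝓞 K)) = Ideal.span {((1951 : ℕ) : ℤ)} ∧
      P.ramificationIdx ℤ = 5

/-- **The fingerprint is finite group theory** (shared by A and C): an element of `GL₂` over an
algebraically closed field of characteristic `0` whose image in `PGL₂` has order `k ∈ {1,2,3,5}` has
`tr² / det ∈ {4, 0, 1, roots of x² - 3x + 1}` respectively (diagonalise: `tr²/det = λ + λ⁻¹ + 2`,
`λ` a primitive `k`-th root of unity). -/
theorem fingerprint_of_projective_order {k : Type*} [Field k] [IsAlgClosed k] [CharZero k]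
    (M : GL (Fin 2) k) (hfin : IsOfFinOrder M)
    (hk : orderOf (Matrix.ProjGenLinGroup.mk M) ∈ ({1, 2, 3, 5} : Set ℕ)) :
    let t := (M : Matrix (Fin 2) (Fin 2) k).trace; let d := (M : Matrix (Fin 2) (Fin 2) k).det
    t ^ 2 = 0 ∨ t ^ 2 = d ∨ t ^ 2 = 4 * d ∨ t ^ 4 - 3 * d * t ^ 2 + d ^ 2 = 0 := by
  sorry

end Summit.Langlands.Langlands.Cruxes.IcosahedralSupply.Sketch

end
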